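import Literature.AlgebraicGeometry.Resolution.ValuedFunctionFields
import Mathlib.FieldTheory.IsAlgClosed.Basic
import Mathlib.RingTheory.IntegralClosure.IntegrallyClosed
import HarnessLib

/-!
# Local uniformization after a finite extension: the ingredients of Knaf–Kuhlmann 2009, Thm. 1.2

Topic: `Literature/AlgebraicGeometry/Resolution`. Second layer of the decomposition of the
named fact `KnafKuhlmann2009` (`LocalUniformization.lean`): the results on which the printed
proof of Knaf–Kuhlmann 2009, Thm. 1.2 (§4.2; pp. 24–25 of arXiv:math/0702856v1) rests, vendored
as named facts in the ambient rendering of `ValuedFunctionFields.lean` (one valued field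
`(Ω, V)`, subfields of `Ω`, valuation rings `V ∩ E`).

## Content (named facts, all `def … : Prop`, users take `(h : …)`)

* `KnafKuhlmann2009_Thm11` — KK09 Thm. 1.1 (existence part): for a separable valued function
  field `(E|K, P)` with `vE/vK` torsion and `EP|KP` algebraic and a finite `Z ⊆ O_P`, there are a
  finite (separable) extension `𝓔|E` inside `E^{sep}` and a finite `𝒦|K` inside `𝓔` such that
  `𝓔|𝒦` has an `O_𝒦`-model smooth at the centre of `P`, on which every `z ∈ Z` factors as
  `z = u z'`, `u` a unit at the centre, `z' ∈ O_𝒦`. (The Galois / separably tame refinements and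
  the `E₀`-clause are not vendored.)
* `KnafKuhlmann2009_Prop23` — KK09 Prop. 2.3: a separable valued function field `(F|K, P)`
  has a separating transcendence basis containing `x₁,…,x_ρ, y₁,…,y_τ` with `(vxᵢ)` a
  ℚ-basis of `(vF/vK) ⊗ ℚ` and `(yⱼP)` a transcendence basis of `FP|KP`.
* `KnafKuhlmann2009_Prop32` — KK09 Prop. 3.2 (descent of a smooth-at-`q` finitely presented
  algebra over a normal domain `S` to normal subrings `S' ⊇ S₀`, `S₀|R` finitely generated),
  for `q` the centre of a valuation ring `V ⊇ A`.
* `KnafKuhlmann2009_Prop34_2` — KK09 Prop. 3.4 (2) (finite descent of smooth uniformizability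
  from an algebraic constant extension `L|K` to a finitely generated subextension `M|K`).
* `KnafKuhlmann2005_Thm11` — KK05 Thm. 1.1 (weak form): a `K`-trivial Abhyankar place with
  `FP|K` separable is, for every finite `Z ⊆ O_P`, `K`-uniformizable on a variety with the
  centre a smooth point and `Z` in its local ring (dimension and monomiality clauses not
  vendored).
* `KnafKuhlmann2005_Cor22` — KK05 Cor. 2.2: for an Abhyankar place of a function field `F|K`,
  `vF/vK` and `FP|KP` are finitely generated.

Nothing is proved here beyond unfolding lemmas; the assembly of Thm. 1.2 from these facts (over
the perfect hull of the ground field, then finite descent by Prop. 3.4 (2)) and of the fact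
`KnafKuhlmann2009` is carried out in later layers.

## Sources

* [KK09] H. Knaf, F.-V. Kuhlmann, *Every place admits local uniformization in a finite
  extension of the function field*, Adv. Math. 221 (2009) 428–453 = arXiv:math/0702856;
  theorem numbers as in both versions; page numbers below refer to the printed pagination of
  arXiv v1 (28 Feb 2007, 27 pp.): Thm. 1.1 (p. 3), Prop. 2.3 (p. 8), §3.1 (p. 14: models,
  smoothness at the centre), Prop. 3.2 (p. 14), Prop. 3.3, Prop. 3.4 (pp. 15–16).
* [KK05] H. Knaf, F.-V. Kuhlmann, *Abhyankar places admit local uniformization in any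
  characteristic*, Ann. Sci. ÉNS 38 (2005) 833–846 = arXiv:math/0304159: Thm. 1.1 (p. 4 of the
  arXiv PDF), Thm. 2.1 and Cor. 2.2 (p. 6 of the arXiv PDF).

## Rendering notes

* Ambient data: `Ω` a field with a valuation subring `V`; the paper's "extension of `P` to
  `E^{sep}`" (Thm. 1.1) is rendered by requiring `Ω` algebraically closed (`E^{sep} ⊆ Ω`; any
  valuation on `E^{sep}` extends to `Ω` by Chevalley's theorem, so nothing is lost) and asking
  the finite extension `𝓔|E` to be separable.
* Field extensions inside `Ω` and their finiteness properties: `FGOver`, `FiniteOver`,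
  `FiniteSeparableOver`, `SeparablyGeneratedOver`
  (`ValuedFunctionFields.lean`). "Separable function field" = separably generated.
* Models: `IsSmoothlyUniformizableIn R V E Z` (`ValuedFunctionFields.lean`); when a statement
  needs the model itself (Thm. 1.1's factorisations, Prop. 3.2) the definition is unfolded:
  an `R`-subalgebra `A ⊆ V` of `Ω`, `Algebra.FinitePresentation R A`, `Frac A = E` as
  `∀ x ∈ E, ∃ a b ∈ A, x = a / b`, smooth at the centre `centre A V _` (`Algebra.IsSmoothAt`;
  KK09 §3.1 and EGA IV 17: for finitely presented algebras "there is `f ∉ q` with `A_f`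
  smooth"), and `z ∈ A_q` as `z = a / b`, `a b ∈ A`, `V.valuation b = 1`; a unit `u` of `A_q` is
  `a / b` with `V.valuation a = V.valuation b = 1`.
* Base rings: outputs use the subrings `V.toSubring ⊓ 𝒦.toSubring` (= `O_𝒦`) or `↥K`; inputs
  of Prop. 3.2 are arbitrary rings `S`, `S'` mapping injectively to `Ω`
  (`Algebra.ofSubsemiring` makes every subring of `Ω` an instance).
* Prop. 3.2 is stated in the paper for an arbitrary prime `q` of `A`; we vendor the case where
  `q` is the centre `𝔪_V ∩ A` of a valuation ring `V ⊇ A` of a field `Ω ⊇ A` (then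
  `A_q ⊆ V` and `q' = qA_q ∩ A'` is the centre of `V` on `A'`), which is the case used in
  §§3–4 of the paper; every prime is such a centre (a valuation ring of `Frac A` dominating
  `A_q`), so this loses nothing.
* Prop. 3.4 (2) is vendored as printed (for `L|K` algebraic; `Z ⊂ O_P` a finite subset of
  the valuation ring of `F`, as in the standing hypotheses of Prop. 3.4; `O_L = V ∩ L`,
  `F.L = F ⊔ L`) but WITHOUT its last sentence ("`M` can be chosen algebraically closed in `F.M`"), which the
  assembly of Thm. 1.2 does not use; "`Z` contains a set of generators of `F|K`" is
  `∃ Z_g ⊆ Z, K(Z_g) = F`. Parts (1) and (3) of Prop. 3.4 are not vendored (the assembly of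
  Thm. 1.2 over the perfect hull needs only (2)).
* KK05 Thm. 1.1: "`K`-uniformizable on a variety `X` such that `P` is centered in a smooth
  point `x ∈ X`" with `Z ⊆ O_{X,x}` is, on an affine neighbourhood of `x`,
  `IsSmoothlyUniformizableIn K V F Z` (a finitely generated `K`-algebra is finitely presented).
  "`FP|K` separable" for the finitely generated (Cor. 2.2) extension `FP|K` = separably
  generated, inside the residue field of `V` (`resField`).
-/

noncomputable section

namespace Literature.AlgebraicGeometry.Resolution

universe u

open IsLocalRing

/-- NAMED FACT — **Knaf–Kuhlmann 2009, Thm. 1.1** (existence part): "Let `(E|K, P)` be a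
separable, valued function field such that `vE/vK` is a torsion group and `EP|KP` is
algebraic. Let `Z ⊂ O_P` be a finite set. Let `𝓟` be an extension of `P` to the separable
closure `E^{sep}` of `E`. Then there exists a finite extension `𝓔|E` within `E^{sep}` and a
finite extension `𝒦|K` within `𝓔` such that the function field `𝓔|𝒦` possesses an `O_𝒦`-model
`X`, `O_𝒦 := O_𝓟 ∩ 𝒦`, with the properties: • `X → Spec O_𝒦` is smooth at the center `x ∈ X`
of `𝓟` on `X`, • every `z ∈ Z` can be expressed as `z = u z'` with some `u ∈ O_{X,x}^×` and
`z' ∈ O_𝒦`." Rendering (module docstring): `Ω ⊇ E` algebraically closed with valuation ring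
`V` (`𝓟 = V ∩ E^{sep}`), `𝓔 ≤ Ω` finite separable over `E`, `K ≤ 𝒦 ≤ 𝓔` finite over `K`, an
affine `O_𝒦`-model `A ⊆ V ∩ 𝓔` (finitely presented, `Frac A = 𝓔`) smooth at the centre, and
`z = (a / b) z'` with `a, b ∈ A` units of `V`, `z' ∈ V ∩ 𝒦`. The options "`𝓔|E` Galois or
inside a separably tame hull" and the `E₀`-clause of the theorem are not vendored. Users take
`(h : KnafKuhlmann2009_Thm11)`. [cite: KnafKuhlmann2009, Thm. 1.1] -/
def KnafKuhlmann2009_Thm11 : Prop :=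
  ∀ (Ω : Type u) [Field Ω] [IsAlgClosed Ω] (V : ValuationSubring Ω) (K E : Subfield Ω),
    K ≤ E → FGOver K E → SeparablyGeneratedOver K E →
    IsValueTorsionOver V K E → IsResiduallyAlgebraicOver V K E →
    ∀ Z : Finset Ω, (∀ z ∈ Z, z ∈ V ∧ z ∈ E) →
    ∃ (𝓔 𝒦 : Subfield Ω), E ≤ 𝓔 ∧ K ≤ 𝒦 ∧ 𝒦 ≤ 𝓔 ∧
      FiniteSeparableOver E 𝓔 ∧ FiniteOver K 𝒦 ∧
      ∃ (A : Subalgebra ↥(V.toSubring ⊓ 𝒦.toSubring) Ω) (hAV : A.toSubring ≤ V.toSubring),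
        (A : Set Ω) ⊆ (𝓔 : Set Ω) ∧ Algebra.FinitePresentation ↥(V.toSubring ⊓ 𝒦.toSubring) A ∧
        (∀ x ∈ 𝓔, ∃ a ∈ A, ∃ b ∈ A, x = a / b) ∧
        Algebra.IsSmoothAt ↥(V.toSubring ⊓ 𝒦.toSubring) (centre A V hAV) ∧
        ∀ z ∈ Z, ∃ a ∈ A, ∃ b ∈ A, ∃ z' ∈ 𝒦, z' ∈ V ∧
          V.valuation a = 1 ∧ V.valuation b = 1 ∧ z = a / b * z'

/-- NAMED FACT — **Knaf–Kuhlmann 2009, Prop. 2.3**: "Let `(F|K, P)` be a valued function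
field and assume that `F|K` is separable. Then there exists a separating transcendence basis
of `F|K` containing elements `x₁,…,x_ρ, y₁,…,y_τ` such that: • the images of `vx₁,…,vx_ρ`
under the natural map `vF → vF/vK ⊗ ℚ` form a basis of the ℚ-vector space on the right side,
• `y₁P,…,y_τP` form a transcendence basis of `FP|KP`." Rendering: the separating transcendence
basis is `{xᵢ} ∪ {yⱼ} ∪ t` (`t` finite; the whole family algebraically independent over `K`,
every element of `F` separable over `K(x, y, t)`); "ℚ-basis" = the values `vxᵢ` are
ℤ-independent modulo `vK` and every value of `Fˣ` has a positive multiple in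
`vK · ∏ (vxᵢ)^ℤ`; "transcendence basis of `FP|KP`" = the residues `yⱼP` are algebraically
independent over `KP` and `FP` is algebraic over `KP(yP)` (in the residue field of `V`).
Users take `(h : KnafKuhlmann2009_Prop23)`. [cite: KnafKuhlmann2009, Prop. 2.3] -/
def KnafKuhlmann2009_Prop23 : Prop :=
  ∀ (Ω : Type u) [Field Ω] (V : ValuationSubring Ω) (K F : Subfield Ω),
    K ≤ F → FGOver K F → SeparablyGeneratedOver K F →
    ∃ (ρ τ : ℕ) (x : Fin ρ → Ω) (y : Fin τ → Ω) (t : Finset Ω) (hy : ∀ j, y j ∈ V),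
      (∀ i, x i ∈ F) ∧ (∀ j, y j ∈ F) ∧ (t : Set Ω) ⊆ F ∧
      AlgebraicIndependent K (Sum.elim (Sum.elim x y) ((↑) : t → Ω)) ∧
      (∀ z ∈ F, IsSeparable
        (IntermediateField.adjoin K (Set.range x ∪ Set.range y ∪ (t : Set Ω))) z) ∧
      (∀ m : Fin ρ → ℤ,
        (∃ b ∈ K, (∏ i, V.valuation (x i) ^ (m i)) = V.valuation b) → m = 0) ∧
      (∀ a ∈ F, a ≠ 0 → ∃ n : ℕ, n ≠ 0 ∧ ∃ (m : Fin ρ → ℤ), ∃ b ∈ K,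
        V.valuation (a ^ n) = V.valuation b * ∏ i, V.valuation (x i) ^ (m i)) ∧
      AlgebraicIndependent (resField V K) (fun j => residue V ⟨y j, hy j⟩) ∧
      ∀ r ∈ resField V F, IsAlgebraic
        (IntermediateField.adjoin (resField V K) (Set.range fun j => residue V ⟨y j, hy j⟩)) r

/-- NAMED FACT — **Knaf–Kuhlmann 2009, Prop. 3.2** (descent of smoothness at a prime):
"Let `A|S` be an extension of domains such that `S` is normal and `A` is a finitely presented
`S`-algebra that is smooth at `q ∈ Spec A`. Let `R ⊆ S` be a subring of `S` and let `Z ⊂ A_q`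
be a finite set. Then there exists a finitely generated ring extension `S₀|R` within `S` with
the property: for every normal domain `S'` with `S₀ ⊆ S' ⊆ S`, there exists a finitely
presented `S'`-algebra `A' ⊆ A_q` that is smooth at `q' := qA_q ∩ A'` and satisfies
`Z ⊂ A'_{q'}`. Moreover for `F := Frac A`, `K := Frac S` and `F' := Frac A'` the relation
`F = F'.K` holds." Rendered (module docstring) for `q` the centre of a valuation ring `V ⊇ A`
of a field `Ω ⊇ A`: `S`, `S'` are normal domains mapping injectively into `Ω`, `S₀` is given by
a finite set of generators over `R` (so "`S₀ ⊆ S'`" is "`R ⊆ S'` and the generators lie in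
`S'`"), `A_q = {a / b : a, b ∈ A, v(b) = 0}`, and `F = F'.K` is
`Frac A = (A' ∪ S)`-generated subfield. Users take `(h : KnafKuhlmann2009_Prop32)`.
[cite: KnafKuhlmann2009, Prop. 3.2] -/
def KnafKuhlmann2009_Prop32 : Prop :=
  ∀ (Ω : Type u) [Field Ω] (V : ValuationSubring Ω)
    (S : Type u) [CommRing S] [IsDomain S] [IsIntegrallyClosed S] [Algebra S Ω],
    Function.Injective (algebraMap S Ω) →
    ∀ (A : Subalgebra S Ω) (hAV : A.toSubring ≤ V.toSubring),
      Algebra.FinitePresentation S A → Algebra.IsSmoothAt S (centre A V hAV) →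
    ∀ (R : Subring Ω), (R : Set Ω) ⊆ Set.range (algebraMap S Ω) →
    ∀ Z : Finset Ω, (∀ z ∈ Z, ∃ a ∈ A, ∃ b ∈ A, V.valuation b = 1 ∧ z = a / b) →
    ∃ S₀ : Finset Ω, (S₀ : Set Ω) ⊆ Set.range (algebraMap S Ω) ∧
      ∀ (S' : Type u) [CommRing S'] [IsDomain S'] [IsIntegrallyClosed S'] [Algebra S' Ω],
        Function.Injective (algebraMap S' Ω) →
        (R : Set Ω) ⊆ Set.range (algebraMap S' Ω) →
        (S₀ : Set Ω) ⊆ Set.range (algebraMap S' Ω) →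
        Set.range (algebraMap S' Ω) ⊆ Set.range (algebraMap S Ω) →
        ∃ (A' : Subalgebra S' Ω) (hA'V : A'.toSubring ≤ V.toSubring),
          (∀ x ∈ A', ∃ a ∈ A, ∃ b ∈ A, V.valuation b = 1 ∧ x = a / b) ∧
          Algebra.FinitePresentation S' A' ∧ Algebra.IsSmoothAt S' (centre A' V hA'V) ∧
          (∀ z ∈ Z, ∃ a ∈ A', ∃ b ∈ A', V.valuation b = 1 ∧ z = a / b) ∧
          Subfield.closure ((A' : Set Ω) ∪ Set.range (algebraMap S Ω)) =
            Subfield.closure (A : Set Ω)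

/-- NAMED FACT — **Knaf–Kuhlmann 2009, Prop. 3.4 (2)**: "Let `(F|K, P)` be a finitely generated,
valued field extension. Let `L|K` be a field extension and assume that `F` and `L` are
subfields of some field `Ω` such that `F` and `L` are algebraically disjoint over `K`. Let `𝓟`
be an extension of `P` to `F.L ⊆ Ω`. […] 2. Assume that `L|K` is algebraic. If `(𝓟, Z)` is
smoothly `O_L`-uniformizable and `Z` contains a set of generators of `F|K`, then there is a
finitely generated subextension `M|K` of `L|K` such that `(𝓟|_{F.M}, Z)` is smoothly
`O_M`-uniformizable. The field `M` can be choosen to be algebraically closed in `F.M`."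
Rendering (module docstring): `L|K` algebraic (then `F`, `L` are automatically algebraically
disjoint over `K`), `Z ⊂ O_P = V ∩ F` finite (standing hypothesis of Prop. 3.4, cf. the proof
of its part (1): "`A ⊂ O_P` such that `Frac A = F` and `Z ⊂ A_q`"), `O_L = V ∩ L`, `F.L = F ⊔ L`;
vendored WITHOUT the last sentence. Users
take `(h : KnafKuhlmann2009_Prop34_2)`. [cite: KnafKuhlmann2009, Prop. 3.4 (2)] -/
def KnafKuhlmann2009_Prop34_2 : Prop :=
  ∀ (Ω : Type u) [Field Ω] (V : ValuationSubring Ω) (K F L : Subfield Ω),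
    K ≤ F → K ≤ L → (∀ x ∈ L, IsAlgebraic K x) →
    ∀ Z : Finset Ω, (∀ z ∈ Z, z ∈ V ∧ z ∈ F) →
      (∃ Zg : Finset Ω, Zg ⊆ Z ∧ Subfield.closure ((K : Set Ω) ∪ Zg) = F) →
      IsSmoothlyUniformizableIn ↥(V.toSubring ⊓ L.toSubring) V (F ⊔ L) Z →
      ∃ M : Subfield Ω, K ≤ M ∧ M ≤ L ∧ FGOver K M ∧
        IsSmoothlyUniformizableIn ↥(V.toSubring ⊓ M.toSubring) V (F ⊔ M) Z

/-- NAMED FACT — **Knaf–Kuhlmann 2005, Thm. 1.1** (weak form): "Let `P` be a `K`-trivial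
Abhyankar place of the function field `F|K`, and assume that `FP|K` is separable. Take a
finite set `Z ⊂ O_P`. Then the pair `(P, Z)` is `K`-uniformizable on a variety `X` such that
`P` is centered in a smooth point `x ∈ X` and `dim O_{X,x} = dim_ℚ(v_P F ⊗ ℚ)`. Moreover, `X`
can be chosen such that all `ζ ∈ Z` are `O_{X,x}`-monomials in `{a₁,…,a_d}` for some regular
parameter system `(a₁,…,a_d)` of `O_{X,x}`." Vendored WITHOUT the dimension and monomiality
clauses: on an affine neighbourhood of `x`, "`X` a variety with function field `F`, smooth
over `K` at the centre `x` of `P`, `Z ⊆ O_{X,x}`" is `IsSmoothlyUniformizableIn K V F Z`;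
"`K`-trivial" is `K ⊆ V`; "`FP|K` separable" (a finitely generated extension, Cor. 2.2) is
"separably generated" inside the residue field of `V`. Users take
`(h : KnafKuhlmann2005_Thm11)`. [cite: KnafKuhlmann2005, Thm. 1.1] -/
def KnafKuhlmann2005_Thm11 : Prop :=
  ∀ (Ω : Type u) [Field Ω] (V : ValuationSubring Ω) (K F : Subfield Ω),
    K ≤ F → FGOver K F → (K : Set Ω) ⊆ V → IsAbhyankarPlace V K F →
    SeparablyGeneratedOver (resField V K) (resField V F) →
    ∀ Z : Finset Ω, (∀ z ∈ Z, z ∈ V ∧ z ∈ F) → IsSmoothlyUniformizableIn K V F Z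

/-- NAMED FACT — **Knaf–Kuhlmann 2005, Cor. 2.2**: "Let `(F|K, P)` be an extension of valued
fields of finite transcendence degree. Then [Abhyankar's inequality] holds. If in addition
`F|K` is a function field, and if equality holds, then the extensions `v_P F | v_P K` and
`FP|KP` are finitely generated. In particular, if `P` is trivial on `K`, then `v_P F` is a
product of finitely many copies of `ℤ`, and `FP` is again a function field over `K`."
Vendored: the two finite generation clauses for an Abhyankar place of a function field
(`vF` is generated modulo `vK` by finitely many values; `FP` is finitely generated over `KP`
inside the residue field of `V`). Users take `(h : KnafKuhlmann2005_Cor22)`.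
[cite: KnafKuhlmann2005, Cor. 2.2] -/
def KnafKuhlmann2005_Cor22 : Prop :=
  ∀ (Ω : Type u) [Field Ω] (V : ValuationSubring Ω) (K F : Subfield Ω),
    K ≤ F → FGOver K F → IsAbhyankarPlace V K F →
    (∃ (ρ : ℕ) (x : Fin ρ → Ω), (∀ i, x i ∈ F ∧ x i ≠ 0) ∧
      ∀ a ∈ F, a ≠ 0 → ∃ (m : Fin ρ → ℤ), ∃ b ∈ K,
        V.valuation a = V.valuation b * ∏ i, V.valuation (x i) ^ (m i)) ∧
    FGOver (resField V K) (resField V F)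

/-! ## API -/

/-- KK09 Thm. 1.1 with `Z = ∅` in the vocabulary of `IsSmoothlyUniformizableIn`: the
`O_𝒦`-model of `𝓔`. [folklore] -/
theorem KnafKuhlmann2009_Thm11.isSmoothlyUniformizableIn (h : KnafKuhlmann2009_Thm11.{u})
    (Ω : Type u) [Field Ω] [IsAlgClosed Ω] (V : ValuationSubring Ω) (K E : Subfield Ω)
    (hKE : K ≤ E) (hfg : FGOver K E) (hsep : SeparablyGeneratedOver K E)
    (htor : IsValueTorsionOver V K E) (halg : IsResiduallyAlgebraicOver V K E) :
    ∃ (𝓔 𝒦 : Subfield Ω), E ≤ 𝓔 ∧ K ≤ 𝒦 ∧ 𝒦 ≤ 𝓔 ∧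
      FiniteSeparableOver E 𝓔 ∧ FiniteOver K 𝒦 ∧
      IsSmoothlyUniformizableIn ↥(V.toSubring ⊓ 𝒦.toSubring) V 𝓔 ∅ := by
  obtain ⟨𝓔, 𝒦, h1, h2, h3, h4, h5, A, hAV, hAE, hfp, hfrac, hsm, -⟩ :=
    h Ω V K E hKE hfg hsep htor halg ∅ (by simp)
  exact ⟨𝓔, 𝒦, h1, h2, h3, h4, h5, A, hAV, hAE, hfp, hfrac, hsm, by simp⟩

/-- KK05 Thm. 1.1 with `Z = ∅`: a `K`-trivial Abhyankar place with separable residue field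
extension is smoothly `K`-uniformizable. [folklore] -/
theorem KnafKuhlmann2005_Thm11.isSmoothlyUniformizableIn (h : KnafKuhlmann2005_Thm11.{u})
    (Ω : Type u) [Field Ω] (V : ValuationSubring Ω) (K F : Subfield Ω) (hKF : K ≤ F)
    (hfg : FGOver K F) (hKV : (K : Set Ω) ⊆ V) (hA : IsAbhyankarPlace V K F)
    (hsep : SeparablyGeneratedOver (resField V K) (resField V F)) :
    IsSmoothlyUniformizableIn K V F ∅ := by
  simpa using h Ω V K F hKF hfg hKV hA hsep ∅ (by simp)

end Literature.AlgebraicGeometry.Resolution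

end
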